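import Literature.AlgebraicGeometry.Deformation.LiftedTransitions
import Literature.AlgebraicGeometry.Deformation.IdealSectionsTransport
import Literature.AlgebraicGeometry.Modules.PullbackFrame
import Literature.AlgebraicGeometry.Modules.CechEndCochain
import HarnessLib

/-!
# The defect of lifted transition matrices as a matrix Čech `2`-cochain on the base

Setting: `j : Y ⟶ Z₀`, `i : Z₀ ⟶ Z₁` morphisms of schemes, an isomorphism of `𝒪_{Z₁}`-modules
`eI : i_* j_* 𝒪_Y ≅ 𝓘 = Ker(i♯)` (`Deformation/IdealSectionsTransport.lean`), an `𝒪_{Z₀}`-module `F`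
with a frame cover `C = (U_a, I_a, e_a)` over opens of `Z₁` and a system of lifts `T̃` of its
transition matrices with defect `c_{abd} = T̃_{ab} T̃_{bd} - T̃_{ad}` (`Deformation/LiftedTransitions.lean`).

* `FrameCover.baseFraming C j` — the framing of `E = j^*F` on `Y` by the pulled-back frames
  `j^*e_a` over `U^Y_a = j⁻¹i⁻¹U_a` (`Modules/PullbackFrame.lean`); its transition matrices are the
  reductions `T̄ = red(T̃)` of the lifted ones (`T_baseFraming`);
* `Lifts.kdefAt L a b d W` — the defect read on `Y`: the matrix `κ(c_{abd})` over `j⁻¹i⁻¹W`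
  with `κ(c).map toIdeal = c` (`IdealSectionsTransport.matrixOfIdeal`); it satisfies the **twisted
  cocycle identity on `Y`** `T̄_{ab} κ_{bdf} - κ_{adf} + κ_{abf} - κ_{abd} T̄_{df} = 0`
  (`kdefAt_cocycle`, from `defect_cocycle`), and under a change of lifts `T̃' = T̃ + H`,
  `κ' - κ = T̄_{ab} κ(H)_{bd} + κ(H)_{ab} T̄_{bd} - κ(H)_{ad}` (`kdefAt_sub_kdefAt`, from
  `defect_sub_defect`, on a first-order thickening);
* `Lifts.defectCochain L` — the matrix `2`-cochain `α ↦ κ(c_{α₀α₁α₂})` of the base framing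
  (`Modules/CechEndCochain.lean`, `Framing.Cochain 2`), and `Lifts.diffCochain L L'` the `1`-cochain
  `α ↦ κ(H_{α₀α₁})` of a change of lifts.

The resulting Čech `2`-cocycle `E ⟶ Č²(𝓤^Y, E)` and its coboundary behaviour are in
`Deformation/ObstructionCocycle.lean`. Everything is proved; no named facts.

## References

* R. Hartshorne, *Deformation Theory*, GTM 257 (2010), §7, proof of Thm. 7.1. [Hartshorne2010]
* The Stacks Project, Tags 08KY, 08L8. [StacksProject]
-/

noncomputable section

open CategoryTheory AlgebraicGeometry Opposite TopologicalSpace Limits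

namespace Literature.AlgebraicGeometry.Deformation

open Literature.AlgebraicGeometry.Modules Literature.AlgebraicGeometry.Motives

universe u

variable {Y Z₀ Z₁ : Scheme.{u}} {j : Y ⟶ Z₀} {i : Z₀ ⟶ Z₁} {F : Z₀.Modules} {ι : Type u}

namespace FrameCover

variable (C : FrameCover i F ι) (j)

/-! ### The base framing of `j^*F` -/

/-- **The framing of `E = j^*F` on `Y` by the pulled-back frames** `j^*e_a : 𝒪^{I_a} ≅ (j^*F)|_{j⁻¹i⁻¹U_a}`
over the opens `U^Y_a = j⁻¹i⁻¹U_a` (reducible: its opens and index types are `baseOpen j i (U a)` and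
`I a` syntactically). [folklore] -/
abbrev baseFraming : Framing ((Scheme.Modules.pullback j).obj F) ι where
  U a := baseOpen j i (C.U a)
  I := C.I
  e a := pullbackFrame j (C.e a)

/-- The opens of the base framing (definitional). [folklore] -/
@[simp] lemma baseFraming_U (a : ι) : (C.baseFraming j).U a = baseOpen j i (C.U a) := rfl

/-- The frames of the base framing (definitional). [folklore] -/
lemma baseFraming_e (a : ι) : (C.baseFraming j).e a = pullbackFrame j (C.e a) := rfl

variable {j}

/-- `j♯` after restriction is `j.appLE`. [folklore] -/
lemma app_secRes_eq_appLE {U : Z₀.Opens} {W : Z₀.Opens} (h : W ≤ U) (x : Γ(Z₀, U)) :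
    j.app W (secRes Z₀ h x) = j.appLE U (j ⁻¹ᵁ W) ((Opens.map j.base).map (homOfLE h)).le x := by
  rw [Scheme.Hom.app_eq_appLE]
  exact ConcreteCategory.congr_hom (j.map_appLE (le_refl (j ⁻¹ᵁ W)) (homOfLE h).op) x

/-- **The transition matrices of the base framing are the reductions of the lifted transition
matrices**: `T(j^*e_a, j^*e_b) = red(T̃_{ab})` over `j⁻¹i⁻¹W`, `W ≤ U_a ∩ U_b`. [folklore] -/
theorem T_baseFraming (L : C.Lifts) (a b : ι) (W : Z₁.Opens) (ha : W ≤ C.U a) (hb : W ≤ C.U b) :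
    (C.baseFraming j).T a b (baseOpen j i W)
        ((Opens.map j.base).map ((Opens.map i.base).map (homOfLE ha))).le
        ((Opens.map j.base).map ((Opens.map i.base).map (homOfLE hb))).le =
      (L.TOn a b W ha hb).map (red j i W) := by
  -- both sides are `T(e_a, e_b)` over `i⁻¹(U_a ∩ U_b)`, restricted to `i⁻¹W` and reduced to `Y`
  have hl : baseOpen j i W ≤ j ⁻¹ᵁ (i ⁻¹ᵁ C.U a ⊓ i ⁻¹ᵁ C.U b) :=
    ((Opens.map j.base).map ((Opens.map i.base).map (homOfLE (le_inf ha hb)))).le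
  have h1 := transition_pullbackFrame j (C.e a) (C.e b) hl
    (homOfLE ((Opens.map j.base).map ((Opens.map i.base).map (homOfLE ha))).le)
    (homOfLE ((Opens.map j.base).map ((Opens.map i.base).map (homOfLE hb))).le)
  have h3 : (L.TOn a b W ha hb).map (red j i W) =
      (C.trans a b (C.U a ⊓ C.U b) inf_le_left inf_le_right).map
        ((j.app (i ⁻¹ᵁ W)).hom ∘ secRes Z₀ ((Opens.map i.base).map (homOfLE (le_inf ha hb))).le) := by
    rw [← Matrix.map_map, C.trans_map a b inf_le_left inf_le_right (le_inf ha hb), ← L.map_TOn a b W ha hb,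
      Matrix.map_map]
    rfl
  refine (h1.trans ?_).trans h3.symm
  ext r s
  simp only [Matrix.map_apply]
  exact (app_secRes_eq_appLE _ _).symm

end FrameCover

/-! ### The defect read on `Y` -/

namespace FrameCover.Lifts

variable {C : FrameCover i F ι}
  (eI : (Scheme.Modules.pushforward i).obj ((Scheme.Modules.pushforward j).obj (unitModule Y)) ≅
    idealModule i)
  (L L' : C.Lifts)

/-- The reduction `T̄_{ab} = red(T̃_{ab})` over `j⁻¹i⁻¹W`: the transition matrix of the pulled-back
frames (`T_baseFraming`). [folklore] -/
abbrev TY (a b : ι) (W : Z₁.Opens) (ha : W ≤ C.U a) (hb : W ≤ C.U b) :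
    Matrix (C.I a) (C.I b) Γ(Y, baseOpen j i W) :=
  (L.TOn a b W ha hb).map (red j i W)

/-- **`κ(c_{abd})`: the defect read on `Y`** over `j⁻¹i⁻¹W`, `W ≤ U_a ∩ U_b ∩ U_d` — the unique matrix of
functions on `Y` with `κ(c).map toIdeal = c`. [cite: Hartshorne2010, §7 (proof of Thm. 7.1)] -/
def kdefAt (a b d : ι) (W : Z₁.Opens) (ha : W ≤ C.U a) (hb : W ≤ C.U b) (hd : W ≤ C.U d) :
    Matrix (C.I a) (C.I d) Γ(Y, baseOpen j i W) :=
  matrixOfIdeal eI W (L.defect a b d W ha hb hd) (L.map_defect a b d W ha hb hd)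

/-- `κ(c).map toIdeal = c`. [folklore] -/
@[simp] lemma map_toIdeal_kdefAt (a b d : ι) (W : Z₁.Opens) (ha : W ≤ C.U a) (hb : W ≤ C.U b)
    (hd : W ≤ C.U d) : (L.kdefAt eI a b d W ha hb hd).map (toIdeal eI W) = L.defect a b d W ha hb hd :=
  map_toIdeal_matrixOfIdeal eI W _ _

/-- **`κ(c)` is compatible with restriction.** [folklore] -/
theorem kdefAt_map (a b d : ι) {W W' : Z₁.Opens} (ha : W ≤ C.U a) (hb : W ≤ C.U b) (hd : W ≤ C.U d)
    (h : W' ≤ W) :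
    (L.kdefAt eI a b d W ha hb hd).map
        (secRes Y ((Opens.map j.base).map ((Opens.map i.base).map (homOfLE h))).le) =
      L.kdefAt eI a b d W' (h.trans ha) (h.trans hb) (h.trans hd) := by
  rw [kdefAt, kdefAt, matrixOfIdeal_map eI h _ _ (by rw [L.defect_map]; exact L.map_defect _ _ _ _ _ _ _)]
  exact matrixOfIdeal_congr eI W' (L.defect_map a b d ha hb hd h) _ _

section Cocycle

variable {eI L}

/-- `matrixOfIdeal` of a zero matrix vanishes. [folklore] -/
lemma matrixOfIdeal_of_eq_zero {m n : Type*} (W : Z₁.Opens) {A : Matrix m n Γ(Z₁, W)} (hA0 : A = 0)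
    (hA : A.map (i.app W).hom = 0) : matrixOfIdeal eI W A hA = 0 := by
  apply matrix_map_toIdeal_injective eI W
  change (matrixOfIdeal eI W A hA).map (toIdeal eI W) = (0 : Matrix m n _).map (toIdeal eI W)
  rw [map_toIdeal_matrixOfIdeal, hA0, Matrix.map_zero _ (map_zero _)]

/-- A product `T̃ c` with `c` killed by `i♯` is killed by `i♯`. [folklore] -/
lemma map_mul_eq_zero_of_right {m n o : Type*} [Fintype n] (W : Z₁.Opens) (T : Matrix m n Γ(Z₁, W))
    {A : Matrix n o Γ(Z₁, W)} (hA : A.map (i.app W).hom = 0) : (T * A).map (i.app W).hom = 0 := by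
  rw [Matrix.map_mul, hA, Matrix.mul_zero]

/-- A product `c T̃` with `c` killed by `i♯` is killed by `i♯`. [folklore] -/
lemma map_mul_eq_zero_of_left {m n o : Type*} [Fintype n] (W : Z₁.Opens) {A : Matrix m n Γ(Z₁, W)}
    (hA : A.map (i.app W).hom = 0) (T : Matrix n o Γ(Z₁, W)) : (A * T).map (i.app W).hom = 0 := by
  rw [Matrix.map_mul, hA, Matrix.zero_mul]

end Cocycle

/-- **The twisted cocycle identity of `κ(c)` on `Y`**:
`T̄_{ab} κ_{bdf} - κ_{adf} + κ_{abf} - κ_{abd} T̄_{df} = 0` over `j⁻¹i⁻¹W`, `W ≤ U_a ∩ U_b ∩ U_d ∩ U_f`.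
[cite: Hartshorne2010, §7 (proof of Thm. 7.1)] -/
theorem kdefAt_cocycle (a b d f : ι) (W : Z₁.Opens) (ha : W ≤ C.U a) (hb : W ≤ C.U b) (hd : W ≤ C.U d)
    (hf : W ≤ C.U f) :
    L.TY a b W ha hb * L.kdefAt eI b d f W hb hd hf - L.kdefAt eI a d f W ha hd hf +
        L.kdefAt eI a b f W ha hb hf - L.kdefAt eI a b d W ha hb hd * L.TY d f W hd hf = 0 := by
  -- the four terms on `Z₁` and their vanishing under `i♯`
  have m1 : (L.TOn a b W ha hb * L.defect b d f W hb hd hf).map (i.app W).hom = 0 :=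
    map_mul_eq_zero_of_right W _ (L.map_defect _ _ _ _ _ _ _)
  have m2 : (L.defect a d f W ha hd hf).map (i.app W).hom = 0 := L.map_defect _ _ _ _ _ _ _
  have m3 : (L.defect a b f W ha hb hf).map (i.app W).hom = 0 := L.map_defect _ _ _ _ _ _ _
  have m4 : (L.defect a b d W ha hb hd * L.TOn d f W hd hf).map (i.app W).hom = 0 :=
    map_mul_eq_zero_of_left W (L.map_defect _ _ _ _ _ _ _) _
  have m12 : (L.TOn a b W ha hb * L.defect b d f W hb hd hf - L.defect a d f W ha hd hf).map
      (i.app W).hom = 0 := by rw [Matrix.map_sub _ (map_sub _), m1, m2, sub_zero]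
  have m123 : (L.TOn a b W ha hb * L.defect b d f W hb hd hf - L.defect a d f W ha hd hf +
      L.defect a b f W ha hb hf).map (i.app W).hom = 0 := by
    rw [Matrix.map_add _ (map_add _), m12, m3, add_zero]
  have m1234 : (L.TOn a b W ha hb * L.defect b d f W hb hd hf - L.defect a d f W ha hd hf +
      L.defect a b f W ha hb hf - L.defect a b d W ha hb hd * L.TOn d f W hd hf).map (i.app W).hom = 0 := by
    rw [Matrix.map_sub _ (map_sub _), m123, m4, sub_zero]
  -- `κ` of the identity `defect_cocycle`
  have key := matrixOfIdeal_of_eq_zero (eI := eI) W (L.defect_cocycle a b d f W ha hb hd hf) m1234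
  rw [matrixOfIdeal_sub eI W _ _ m123 m4, matrixOfIdeal_add eI W _ _ m12 m3,
    matrixOfIdeal_sub eI W _ _ m1 m2, matrixOfIdeal_mul_left eI W _ _ (L.map_defect _ _ _ _ _ _ _) m1,
    matrixOfIdeal_mul_right eI W _ _ (L.map_defect _ _ _ _ _ _ _) m4] at key
  exact key

/-- **`κ` of a change of lifts**: `κ(H_{ab})` over `j⁻¹i⁻¹W` for `H = T̃' - T̃`. [folklore] -/
def kdiffAt (a b : ι) (W : Z₁.Opens) (ha : W ≤ C.U a) (hb : W ≤ C.U b) :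
    Matrix (C.I a) (C.I b) Γ(Y, baseOpen j i W) :=
  matrixOfIdeal eI W (diff L L' a b W ha hb) (map_diff L L' a b W ha hb)

/-- `κ(H)` is compatible with restriction. [folklore] -/
theorem kdiffAt_map (a b : ι) {W W' : Z₁.Opens} (ha : W ≤ C.U a) (hb : W ≤ C.U b) (h : W' ≤ W) :
    (kdiffAt eI L L' a b W ha hb).map
        (secRes Y ((Opens.map j.base).map ((Opens.map i.base).map (homOfLE h))).le) =
      kdiffAt eI L L' a b W' (h.trans ha) (h.trans hb) := by
  rw [kdiffAt, kdiffAt, matrixOfIdeal_map eI h _ _ (by rw [diff_map]; exact map_diff _ _ _ _ _ _ _)]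
  exact matrixOfIdeal_congr eI W' (diff_map L L' a b ha hb h) _ _

/-- **Change of lifts, read on `Y`** (first-order thickening):
`κ(c')_{abd} - κ(c)_{abd} = T̄_{ab} κ(H)_{bd} + κ(H)_{ab} T̄_{bd} - κ(H)_{ad}`.
[cite: Hartshorne2010, §7 (proof of Thm. 7.1)] -/
theorem kdefAt_sub_kdefAt [IsFirstOrderThickening i] (a b d : ι) (W : Z₁.Opens) (ha : W ≤ C.U a)
    (hb : W ≤ C.U b) (hd : W ≤ C.U d) :
    L'.kdefAt eI a b d W ha hb hd - L.kdefAt eI a b d W ha hb hd =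
      L.TY a b W ha hb * kdiffAt eI L L' b d W hb hd + kdiffAt eI L L' a b W ha hb * L.TY b d W hb hd -
        kdiffAt eI L L' a d W ha hd := by
  have m1 : (L.TOn a b W ha hb * diff L L' b d W hb hd).map (i.app W).hom = 0 :=
    map_mul_eq_zero_of_right W _ (map_diff _ _ _ _ _ _ _)
  have m2 : (diff L L' a b W ha hb * L.TOn b d W hb hd).map (i.app W).hom = 0 :=
    map_mul_eq_zero_of_left W (map_diff _ _ _ _ _ _ _) _
  have m3 : (diff L L' a d W ha hd).map (i.app W).hom = 0 := map_diff _ _ _ _ _ _ _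
  have m12 : (L.TOn a b W ha hb * diff L L' b d W hb hd + diff L L' a b W ha hb * L.TOn b d W hb hd).map
      (i.app W).hom = 0 := by rw [Matrix.map_add _ (map_add _), m1, m2, add_zero]
  have m123 : (L.TOn a b W ha hb * diff L L' b d W hb hd + diff L L' a b W ha hb * L.TOn b d W hb hd -
      diff L L' a d W ha hd).map (i.app W).hom = 0 := by rw [Matrix.map_sub _ (map_sub _), m12, m3, sub_zero]
  have hsub : (L'.defect a b d W ha hb hd - L.defect a b d W ha hb hd).map (i.app W).hom = 0 := by
    rw [Matrix.map_sub _ (map_sub _), L'.map_defect, L.map_defect, sub_zero]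
  have key := matrixOfIdeal_congr eI W (defect_sub_defect L L' a b d W ha hb hd) hsub m123
  rw [matrixOfIdeal_sub eI W _ _ (L'.map_defect _ _ _ _ _ _ _) (L.map_defect _ _ _ _ _ _ _),
    matrixOfIdeal_sub eI W _ _ m12 m3, matrixOfIdeal_add eI W _ _ m1 m2,
    matrixOfIdeal_mul_left eI W _ _ (map_diff _ _ _ _ _ _ _) m1,
    matrixOfIdeal_mul_right eI W _ _ (map_diff _ _ _ _ _ _ _) m2] at key
  exact key

/-! ### The defect cochain of the base framing -/

/-- `V ≤ j⁻¹i⁻¹(U_{α₀} ∩ U_{α₁} ∩ U_{α₂})` from `V ≤ U^Y_{α_k}`. [folklore] -/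
lemma le_baseOpen_inf₃ {V : Y.Opens} {a b d : ι} (ha : V ≤ baseOpen j i (C.U a))
    (hb : V ≤ baseOpen j i (C.U b)) (hd : V ≤ baseOpen j i (C.U d)) :
    V ≤ baseOpen j i (C.U a ⊓ C.U b ⊓ C.U d) :=
  le_inf (le_inf ha hb) hd

/-- `V ≤ j⁻¹i⁻¹(U_{α₀} ∩ U_{α₁})` from `V ≤ U^Y_{α_k}`. [folklore] -/
lemma le_baseOpen_inf₂ {V : Y.Opens} {a b : ι} (ha : V ≤ baseOpen j i (C.U a))
    (hb : V ≤ baseOpen j i (C.U b)) : V ≤ baseOpen j i (C.U a ⊓ C.U b) :=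
  le_inf ha hb

/-- **The defect `2`-cochain `α ↦ κ(c_{α₀α₁α₂})` of the base framing.**
[cite: Hartshorne2010, §7 (proof of Thm. 7.1)] -/
def defectCochain : (C.baseFraming j).Cochain 2 where
  mat α V hV :=
    (L.kdefAt eI (α 0) (α 1) (α (Fin.last 2)) (C.U (α 0) ⊓ C.U (α 1) ⊓ C.U (α (Fin.last 2)))
        (inf_le_left.trans inf_le_left) (inf_le_left.trans inf_le_right) inf_le_right).map
      (secRes Y (le_baseOpen_inf₃ (hV 0) (hV 1) (hV (Fin.last 2))))
  map_mat α V V' hV h := by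
    rw [Matrix.map_map]
    congr 1
    funext x
    exact secRes_secRes _ _ _

/-- Matrices of the defect cochain. [folklore] -/
lemma defectCochain_mat (α : Fin 3 → ι) (V : Y.Opens) (hV : ∀ k, V ≤ (C.baseFraming j).U (α k)) :
    (L.defectCochain eI).mat α V hV =
      (L.kdefAt eI (α 0) (α 1) (α (Fin.last 2)) (C.U (α 0) ⊓ C.U (α 1) ⊓ C.U (α (Fin.last 2)))
          (inf_le_left.trans inf_le_left) (inf_le_left.trans inf_le_right) inf_le_right).map
        (secRes Y (le_baseOpen_inf₃ (hV 0) (hV 1) (hV (Fin.last 2)))) :=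
  rfl

/-- **The change-of-lifts `1`-cochain `α ↦ κ(H_{α₀α₁})`.** [folklore] -/
def diffCochain : (C.baseFraming j).Cochain 1 where
  mat α V hV :=
    (kdiffAt eI L L' (α 0) (α (Fin.last 1)) (C.U (α 0) ⊓ C.U (α (Fin.last 1))) inf_le_left inf_le_right).map
      (secRes Y (le_baseOpen_inf₂ (hV 0) (hV (Fin.last 1))))
  map_mat α V V' hV h := by
    rw [Matrix.map_map]
    congr 1
    funext x
    exact secRes_secRes _ _ _

/-- Matrices of the change-of-lifts cochain. [folklore] -/
lemma diffCochain_mat (α : Fin 2 → ι) (V : Y.Opens) (hV : ∀ k, V ≤ (C.baseFraming j).U (α k)) :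
    (diffCochain eI L L').mat α V hV =
      (kdiffAt eI L L' (α 0) (α (Fin.last 1)) (C.U (α 0) ⊓ C.U (α (Fin.last 1))) inf_le_left
          inf_le_right).map (secRes Y (le_baseOpen_inf₂ (hV 0) (hV (Fin.last 1)))) :=
  rfl

end FrameCover.Lifts

end Literature.AlgebraicGeometry.Deformation

end
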